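import Literature.Geometry.ComplexAnalytic.PhamBrieskornJoinMultiplicity
import Mathlib.RingTheory.RootsOfUnity.Basic
import Mathlib.RingTheory.IntegralDomain
import HarnessLib

/-!
# Every character of `Ω_{a₀} × ⋯ × Ω_{aₙ}` non-trivial on each factor occurs in `Hₙ(Ω_{a₀} * ⋯ * Ω_{aₙ}; ℂ)`, and characters trivial on a factor do not (Pham 1965; Milnor 1968, Thm. 9.1)

Milnor, *Singular points of complex hypersurfaces* (1968), §9, Thm. 9.1 and p. 77, on the join
`J = Ω_{a₁} * ⋯ * Ω_{a_m}` (the deformation retract of the Milnor fibre of `Σ zⱼ^{aⱼ}`, Lemma 9.2):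
"`H̃_{m-1} J = H̃₀Ω_{a₁} ⊗ ⋯ ⊗ H̃₀Ω_{a_m}` […] The eigenvalues of `r_{a*}` [on `H̃₀(Ω_a; ℂ)`] are
clearly the `a`-th roots of unity, other than `1`"; Dimca, *Singularities and Topology of
Hypersurfaces* (1992), Ch. 3 (1.16) and (3.1.12): the torus `Ω_{a₀} × ⋯ × Ω_{aₙ}` of
coordinatewise rotations acts on `H̃ₙ(J; ℂ) = ⊗ⱼ Ĩ(ℂΩ_{aⱼ})` (`Ĩ` the augmentation ideal of the
group ring, i.e. the regular representation minus the trivial one), so that a character of the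
torus OCCURS in `Hₙ(J; ℂ)` (`n ≥ 1`) IF AND ONLY IF it is non-trivial on every factor, and then
exactly once. The tree's `PhamBrieskornJoinMultiplicity` proves "at most once"
(`exists_covariants_le_span`); this PROOF FILE (theorems only; no definition,
no named fact, D-0026) supplies the two remaining halves, in the forms consumed by the cohomology
of the Fermat hypersurfaces (`Literature/AlgebraicGeometry/HodgeTheory/Fermat*`; Ran, Compositio
Math. 42 (1980) §1 Prop. 1.7 (i): "each `H_χ` is 1-dimensional", `χ` relevant):

* `PhamBrieskorn.exists_reindex` — re-indexing the coordinates along `s : ι' ≃ ι` is a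
  homeomorphism `J_a ≃ₜ J_{a ∘ s}` intertwining the torus actions (`reindex_comp_act`);
* `PhamBrieskorn.eq_zero_of_forall_actRep_mulSingle_eq` — **no invariants of a single factor**
  (equal exponents `aⱼ = m`, `n + 1 ≥ 2` factors): a class of `Hₙ(J; ℂ)` fixed by the rotations of
  ONE coordinate `j` vanishes (the tree's `eq_zero_of_forall_map_rotate_eq` for the last
  coordinate, transported along the transposition `j ↔ last`);
* `PhamBrieskorn.covariants_eq_bot_of_trivial` — dually, **for a character `θ` trivial on some
  factor the `θ`-covariant functionals on `Hₙ(J; ℂ)` vanish** (average over that factor);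
* `PhamBrieskorn.exists_eigenvector` — **EXISTENCE: for every character `θ` of the torus
  non-trivial on every factor there is a non-zero `x ∈ Hₙ(J; ℂ)` with `(act u)_* x = θ(u) x`**
  (any exponents `aⱼ ≠ 0`, any `n`). Proof by Milnor's induction on the number of factors through
  the tree's equivariant Mayer–Vietoris embedding `Ψ : Hₙ₊₁(J) ↪ ⊕_ω Hₙ(J')`
  (`PhamBrieskornJoinMultiplicity.Psi`, `Psi_actRep`): given a `θ'`-eigenvector `y` of `Hₙ(J')`,
  the family `(θ(1,…,1,ω)⁻¹ y)_ω` lies in the image of the Mayer–Vietoris boundary because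
  `Σ_ω θ(1,…,1,ω)⁻¹ = 0` (exactness of Mayer–Vietoris at `Hₙ(U ∩ V)`, the tree's `exact₃_holds`),
  and its preimage is the required eigenvector; the base is the regular representation of `Ω_{a₀}`
  on `H₀(Ω_{a₀}; ℂ)`, where `Σ_u θ(u)⁻¹ [u · 1]` is a `θ`-eigenvector.

## References

* [Milnor1968] J. Milnor, Singular Points of Complex Hypersurfaces, Ann. of Math. Studies 61
  (1968), §9, Thm. 9.1, Lemma 9.2 and p. 77.
* [Pham1965] F. Pham, Formules de Picard–Lefschetz généralisées et ramification des intégrales,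
  Bull. Soc. Math. France 93 (1965) 333–367, §1.
* [Dimca1992] A. Dimca, Singularities and Topology of Hypersurfaces, Springer 1992, Ch. 3 (1.16)
  and (3.1.12).
* [HatcherAT2002] A. Hatcher, Algebraic Topology, CUP 2002, §2.2 pp. 149–150 (Mayer–Vietoris),
  Prop. 2.6 (additivity), Prop. 2.7 (`H₀`).
-/

noncomputable section

open Complex ContinuousMap Set Filter CategoryTheory Limits
open Literature.AlgebraicTopology.SingularHomology
open scoped unitInterval Topology

namespace Literature.Geometry.ComplexAnalytic

namespace PhamBrieskorn

/-! ### Re-indexing the coordinates of the join -/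

section Reindex

variable {ι ι' : Type} [Fintype ι] [Fintype ι'] {a : ι → ℕ}

/-- A point of `J_a` read along `s : ι' ≃ ι` is a point of `J_{a ∘ s}`. [cite: Milnor1968, §9 p. 76] -/
theorem comp_equiv_mem_join (s : ι' ≃ ι) {z : ι → ℂ} (hz : z ∈ join a) : (z ∘ s) ∈ join (a ∘ s) := by
  refine ⟨?_, fun i ↦ hz.2 (s i)⟩
  have h : ∑ i, (z ∘ s) i ^ (a ∘ s) i = ∑ i, z i ^ a i := Equiv.sum_comp s (fun i ↦ z i ^ a i)
  rw [h]
  exact hz.1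

/-- The inverse re-indexing lands in `J_a`. [cite: Milnor1968, §9 p. 76] -/
theorem comp_equiv_symm_mem_join (s : ι' ≃ ι) {w : ι' → ℂ} (hw : w ∈ join (a ∘ s)) :
    (fun i ↦ w (s.symm i)) ∈ join a := by
  refine ⟨?_, fun i ↦ ?_⟩
  · have h : ∑ i, w (s.symm i) ^ a i = ∑ i, w i ^ (a ∘ s) i := by
      rw [← Equiv.sum_comp s (fun i ↦ w (s.symm i) ^ a i)]
      exact Finset.sum_congr rfl fun i _ ↦ by simp
    rw [h]
    exact hw.1
  · have h := hw.2 (s.symm i)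
    simpa using h

/-- **Re-indexing the coordinates along `s : ι' ≃ ι` gives a homeomorphism `J_a ≃ₜ J_{a ∘ s}`,
`z ↦ z ∘ s`.** [cite: Milnor1968, §9 p. 76] -/
theorem exists_reindex (s : ι' ≃ ι) :
    ∃ e : join a ≃ₜ join (a ∘ s), ∀ z, ((e z : join (a ∘ s)) : ι' → ℂ) = (z : ι → ℂ) ∘ s :=
  ⟨{ toFun := fun z ↦ ⟨(z : ι → ℂ) ∘ s, comp_equiv_mem_join s z.2⟩
     invFun := fun w ↦ ⟨fun i ↦ (w : ι' → ℂ) (s.symm i), comp_equiv_symm_mem_join s w.2⟩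
     left_inv := fun z ↦ Subtype.ext (funext fun i ↦ by simp)
     right_inv := fun w ↦ Subtype.ext (funext fun i ↦ by simp)
     continuous_toFun :=
       ((continuous_pi fun i ↦ continuous_apply (s i)).comp continuous_subtype_val).subtype_mk _
     continuous_invFun :=
       ((continuous_pi fun i ↦ continuous_apply (s.symm i)).comp continuous_subtype_val).subtype_mk _ },
    fun _ ↦ rfl⟩

/-- **Re-indexing intertwines the torus actions**: `e ∘ act u = act (u ∘ s) ∘ e` for the
re-indexing homeomorphism `e : z ↦ z ∘ s`. [cite: Milnor1968, §9 p. 77] -/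
theorem reindex_comp_act {s : ι' ≃ ι} {e : join a ≃ₜ join (a ∘ s)}
    (he : ∀ z, ((e z : join (a ∘ s)) : ι' → ℂ) = (z : ι → ℂ) ∘ s) (u : Torus a) :
    (e : C(join a, join (a ∘ s))).comp (act a u : C(join a, join a)) =
      (act (a ∘ s) (fun i ↦ u (s i)) : C(join (a ∘ s), join (a ∘ s))).comp
        (e : C(join a, join (a ∘ s))) := by
  ext z : 1
  refine Subtype.ext ?_
  change ((e (act a u z) : join (a ∘ s)) : ι' → ℂ) = unitVec (fun i ↦ u (s i)) * ((e z : join (a ∘ s)) : ι' → ℂ)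
  rw [he, he, act_apply_coe]
  rfl

/-- On homology: `e_* ((act u)_* x) = (act (u ∘ s))_* (e_* x)`. [cite: Milnor1968, §9 p. 77] -/
theorem map_reindex_actRep {s : ι' ≃ ι} {e : join a ≃ₜ join (a ∘ s)}
    (he : ∀ z, ((e z : join (a ∘ s)) : ι' → ℂ) = (z : ι → ℂ) ∘ s) (u : Torus a) (b : ℕ)
    (x : singularHomology ℂ ℂ (join a) b) :
    singularHomology.map ℂ ℂ (e : C(join a, join (a ∘ s))) b (actRep a b u x) =
      actRep (a ∘ s) b (fun i ↦ u (s i))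
        (singularHomology.map ℂ ℂ (e : C(join a, join (a ∘ s))) b x) := by
  rw [actRep, actRep, ← ModuleCat.comp_apply, ← singularHomology.map_comp, reindex_comp_act he,
    singularHomology.map_comp, ModuleCat.comp_apply]

/-- A homeomorphism is injective on homology. [folklore] -/
theorem map_homeomorph_injective {X Y : Type} [TopologicalSpace X] [TopologicalSpace Y]
    (e : X ≃ₜ Y) (b : ℕ) :
    Function.Injective (singularHomology.map ℂ ℂ (e : C(X, Y)) b) :=
  ((forget (ModuleCat ℂ)).mapIso (singularHomology.mapIso ℂ ℂ e b)).toEquiv.injective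

end Reindex

/-! ### No invariants of a single factor (equal exponents) -/

section Invariants

variable {n : ℕ} {m : ℕ} (hm : m ≠ 0)

/-- The rotation of the last coordinate is the action of `(1, …, 1, v)`.
[cite: Milnor1968, §9 p. 77] -/
theorem rotate_eq_act {a : Fin (n + 2) → ℕ} (ha : ∀ i, a i ≠ 0) (v : Omega (a (Fin.last (n + 1)))) :
    (rotate a ha v : C(join a, join a)) = (act a (torusOfLast ha v) : C(join a, join a)) := by
  ext z : 1
  refine Subtype.ext (funext fun i ↦ ?_)
  change rotateFun (v : ℂ) (z : Fin (n + 2) → ℂ) i = unitVec (torusOfLast ha v) i * (z : Fin (n + 2) → ℂ) i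
  refine Fin.lastCases ?_ (fun j ↦ ?_) i
  · rw [rotateFun_last, unitVec_apply]
    congr 1
    simp [torusOfLast, toRoot]
  · rw [rotateFun_castSucc, unitVec_apply]
    simp [torusOfLast]

include hm in
/-- **A class of `Hₙ₊₁(J; ℂ)` fixed by the rotations of one coordinate `j` vanishes** (`J` the join
of `n + 2 ≥ 2` copies of `Ω_m`): for `j` the last coordinate this is the tree's
`eq_zero_of_forall_map_rotate_eq` (the last factor acts on `H̃ₙ₊₁(J) = H̃ₙ(J') ⊗ H̃₀(Ω_m)` through
the regular representation minus the trivial one); the general case is transported along the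
coordinate transposition `j ↔ last`, a homeomorphism of `J` intertwining the actions.
[cite: Milnor1968, §9 Thm. 9.1 and p. 77] [cite: Dimca1992, Ch. 3 (1.16)] -/
theorem eq_zero_of_forall_actRep_mulSingle_eq (j : Fin (n + 2))
    (x : singularHomology ℂ ℂ (join (fun _ : Fin (n + 2) ↦ m)) (n + 1))
    (hx : ∀ ζ : rootsOfUnity m ℂ,
      actRep (fun _ : Fin (n + 2) ↦ m) (n + 1) (Pi.mulSingle j ζ) x = x) : x = 0 := by
  classical
  have ha : ∀ i : Fin (n + 2), (fun _ : Fin (n + 2) ↦ m) i ≠ 0 := fun _ ↦ hm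
  set s : Fin (n + 2) ≃ Fin (n + 2) := Equiv.swap j (Fin.last (n + 1)) with hs
  -- transport to the re-indexed join (same exponents), where `j` has become the last coordinate
  obtain ⟨e₀, he₀⟩ := exists_reindex (a := fun _ : Fin (n + 2) ↦ m) s
  let e : C(join (fun _ : Fin (n + 2) ↦ m), join (fun _ : Fin (n + 2) ↦ m)) :=
    (e₀ : C(join (fun _ : Fin (n + 2) ↦ m), join ((fun _ : Fin (n + 2) ↦ m) ∘ s)))
  have hy : ∀ v : Omega ((fun _ : Fin (n + 2) ↦ m) (Fin.last (n + 1))),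
      singularHomology.map ℂ ℂ (rotate (fun _ : Fin (n + 2) ↦ m) ha v :
          C(join (fun _ : Fin (n + 2) ↦ m), join (fun _ : Fin (n + 2) ↦ m))) (n + 1)
        (singularHomology.map ℂ ℂ e (n + 1) x) = singularHomology.map ℂ ℂ e (n + 1) x := by
    intro v
    rw [rotate_eq_act ha v]
    -- `torusOfLast v = (mulSingle j ζ) ∘ s` for `ζ = v`
    have hu : (fun i ↦ (Pi.mulSingle j (toRoot ha v) : Fin (n + 2) → rootsOfUnity m ℂ) (s i)) =
        torusOfLast ha v := by
      funext i
      refine Fin.lastCases ?_ (fun i' ↦ ?_) i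
      · rw [hs, Equiv.swap_apply_right, Pi.mulSingle_eq_same]
        simp [torusOfLast]
      · have hne : s i'.castSucc ≠ j := by
          intro h
          have h2 : i'.castSucc = s.symm j := by rw [← h, Equiv.symm_apply_apply]
          rw [hs, Equiv.symm_swap, Equiv.swap_apply_left] at h2
          exact (Fin.castSucc_lt_last i').ne h2
        rw [Pi.mulSingle_eq_of_ne hne]
        simp [torusOfLast]
    have h := map_reindex_actRep (a := fun _ : Fin (n + 2) ↦ m) he₀ (Pi.mulSingle j (toRoot ha v)) (n + 1) x
    rw [hx, hu] at h
    exact h.symm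
  have hy0 := eq_zero_of_forall_map_rotate_eq ℂ ha _ hy
  exact map_homeomorph_injective e₀ (n + 1) (by rw [map_zero]; exact hy0)

include hm in
/-- **For a character `θ` of `Ω_mⁿ⁺²` trivial on some factor `j`, the `θ`-covariant functionals on
`Hₙ₊₁(J; ℂ)` vanish** (`J` the join of `n + 2 ≥ 2` copies of `Ω_m`): a covariant functional
takes the same value on `x` and on its average over the `j`-th factor, which is fixed by that
factor and hence zero. (The trivial character of `Ω_m` does not occur in `H̃₀(Ω_m)`.)
[cite: Milnor1968, §9 Thm. 9.1 and p. 77] [cite: Dimca1992, Ch. 3 (1.16)] -/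
theorem covariants_eq_bot_of_trivial (j : Fin (n + 2)) (θ : Torus (fun _ : Fin (n + 2) ↦ m) →* ℂˣ)
    (hθ : ∀ ζ : rootsOfUnity m ℂ, θ (Pi.mulSingle j ζ) = 1) :
    covariants (actRep (fun _ : Fin (n + 2) ↦ m) (n + 1)) (fun u ↦ ((θ u : ℂˣ) : ℂ)) = ⊥ := by
  classical
  haveI : NeZero m := ⟨hm⟩
  haveI : Fintype (rootsOfUnity m ℂ) := Fintype.ofFinite _
  set a : Fin (n + 2) → ℕ := fun _ ↦ m with ha_def
  rw [eq_bot_iff]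
  intro f hf
  rw [Submodule.mem_bot]
  refine LinearMap.ext fun x ↦ ?_
  rw [LinearMap.zero_apply]
  -- the average of `x` over the `j`-th factor
  set avg : singularHomology ℂ ℂ (join a) (n + 1) :=
    ∑ ζ : rootsOfUnity m ℂ, actRep a (n + 1) (Pi.mulSingle j ζ) x with havg
  have hfix : ∀ ζ : rootsOfUnity m ℂ, actRep a (n + 1) (Pi.mulSingle j ζ) avg = avg := by
    intro ζ
    rw [havg, map_sum]
    simp_rw [← LinearMap.comp_apply, ← actRep_mul, ← Pi.mulSingle_mul]
    exact Fintype.sum_equiv (Equiv.mulLeft ζ) _ _ fun _ ↦ rfl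
  have havg0 : avg = 0 := eq_zero_of_forall_actRep_mulSingle_eq hm j avg hfix
  have hfavg : f avg = (Fintype.card (rootsOfUnity m ℂ) : ℂ) * f x := by
    rw [havg, map_sum]
    have h : ∀ ζ : rootsOfUnity m ℂ, f (actRep a (n + 1) (Pi.mulSingle j ζ) x) = f x := by
      intro ζ
      rw [apply_of_mem_covariants hf, hθ ζ, Units.val_one, one_mul]
    simp only [h, Finset.sum_const, Finset.card_univ, nsmul_eq_mul]
  rw [havg0, map_zero] at hfavg
  have hcard : (Fintype.card (rootsOfUnity m ℂ) : ℂ) ≠ 0 := by exact_mod_cast Fintype.card_ne_zero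
  exact (mul_eq_zero.mp hfavg.symm).resolve_left hcard

end Invariants

/-! ### Existence of eigenvectors: the base, `H₀(Ω_{a₀}; ℂ)` -/

section Base

variable {a : Fin 1 → ℕ} (ha : ∀ i, a i ≠ 0)

/-- `u ↦ u · (1)` is injective on the torus of the one-factor join. [cite: Milnor1968, §9 p. 76] -/
theorem act_basePt_injective : Function.Injective fun u : Torus a ↦ act a u basePt := by
  intro u u' h
  funext i
  have h1 := congrArg (fun z : join a ↦ (z : Fin 1 → ℂ) i) h
  simp only [act_apply_coe, Pi.mul_apply, unitVec_apply] at h1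
  have hb : ((basePt (a := a) : join a) : Fin 1 → ℂ) i = 1 := rfl
  rw [hb, mul_one, mul_one] at h1
  exact Subtype.ext (Units.ext h1)

include ha in
/-- **The base of the induction: `Σ_u θ(u)⁻¹ [u · 1]` is a non-zero `θ`-eigenvector of
`H₀(Ω_{a₀}; ℂ)`** for every character `θ` of `Ω_{a₀}` (the regular representation contains every
character once). [cite: Milnor1968, §9 p. 77] [cite: HatcherAT2002, Prop. 2.6 and Prop. 2.7] -/
theorem exists_eigenvector_base (θ : Torus a →* ℂˣ) :
    ∃ x : singularHomology ℂ ℂ (join a) 0, x ≠ 0 ∧ ∀ u, actRep a 0 u x = ((θ u : ℂˣ) : ℂ) • x := by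
  classical
  haveI : Finite (Torus a) := finite_torus ha
  haveI : Fintype (Torus a) := Fintype.ofFinite _
  set x : singularHomology ℂ ℂ (join a) 0 :=
    ∑ u : Torus a, (((θ u)⁻¹ : ℂˣ) : ℂ) • ptClass (act a u basePt) with hx
  refine ⟨x, ?_, fun w ↦ ?_⟩
  · -- non-vanishing: read the coefficient at one point through the clopen decomposition
    intro hx0
    haveI : Finite (join a) := (finite_join_fin_one ha).to_subtype
    haveI : Fintype (join a) := Fintype.ofFinite _
    haveI : DiscreteTopology (join a) := inferInstance
    have hpart : IsClopenPartition fun p : join a ↦ ({p} : Set (join a)) :=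
      { isOpen := fun p ↦ isOpen_discrete _
        disjoint := fun p q hpq ↦ Set.disjoint_singleton.2 hpq
        exists_mem := fun z ↦ ⟨z, rfl⟩ }
    -- the point-class of `p` as a push-forward from `{p}`
    let eC : ∀ p : join a, C(PUnit.{1}, (({p} : Set (join a)) : Type)) :=
      fun p ↦ ⟨fun _ ↦ ⟨p, rfl⟩, continuous_const⟩
    let eC' : ∀ p : join a, C((({p} : Set (join a)) : Type), PUnit.{1}) :=
      fun p ↦ ⟨fun _ ↦ PUnit.unit, continuous_const⟩
    have hpt : ∀ p : join a, ptClass p =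
        singularHomology.map ℂ ℂ (subsetIncl ({p} : Set (join a))) 0
          (singularHomology.map ℂ ℂ (eC p) 0 gen) := by
      intro p
      rw [ptClass, ← ModuleCat.comp_apply, ← singularHomology.map_comp]
      rfl
    -- re-index the sum over the points
    let φ : Torus a ≃ join a := Equiv.ofBijective (fun u ↦ act a u basePt)
      ⟨act_basePt_injective, exists_act_basePt ha⟩
    let c : join a → ℂ := fun p ↦ (((θ (φ.symm p))⁻¹ : ℂˣ) : ℂ)
    have hxsum : x = ∑ p : join a, singularHomology.map ℂ ℂ (subsetIncl ({p} : Set (join a))) 0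
        (c p • singularHomology.map ℂ ℂ (eC p) 0 gen) := by
      rw [hx, ← Equiv.sum_comp φ]
      refine Finset.sum_congr rfl fun u _ ↦ ?_
      rw [map_smul, ← hpt]
      simp [c, φ]
    have hzero := singularHomology.eq_zero_of_sum_map_subsetIncl_eq_zero (R := ℂ) (M := ℂ) hpart 0
      Finset.univ (fun p ↦ c p • singularHomology.map ℂ ℂ (eC p) 0 gen)
      (by rw [← hxsum]; exact hx0) (basePt (a := a)) (Finset.mem_univ _)
    have hc : c basePt ≠ 0 := Units.ne_zero _
    have hg : singularHomology.map ℂ ℂ (eC basePt) 0 gen = 0 := (smul_eq_zero.mp hzero).resolve_left hc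
    have hgen : gen = 0 := by
      have h := congrArg (singularHomology.map ℂ ℂ (eC' basePt) 0) hg
      rw [map_zero, ← ModuleCat.comp_apply, ← singularHomology.map_comp] at h
      have hid : (eC' (basePt (a := a))).comp (eC basePt) = ContinuousMap.id _ :=
        ContinuousMap.ext fun _ ↦ rfl
      rwa [hid, singularHomology.map_id] at h
    have h1 := ε_gen
    rw [hgen, map_zero] at h1
    exact zero_ne_one (congrArg ULift.down h1)
  · -- eigenvector
    rw [hx, map_sum]
    simp_rw [map_smul, actRep_ptClass, act_act]
    rw [Finset.smul_sum]
    simp_rw [smul_smul]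
    refine Fintype.sum_equiv (Equiv.mulLeft w) _ _ fun u ↦ ?_
    simp only [Equiv.coe_mulLeft]
    congr 1
    rw [map_mul, mul_inv, Units.val_mul, Units.mul_inv_cancel_left]

end Base

/-! ### Existence of eigenvectors: the inductive step -/

section Step

variable {n : ℕ} {a : Fin (n + 2) → ℕ} (ha : ∀ i, a i ≠ 0)
variable [Fintype (Omega (a (Fin.last (n + 1))))]

omit [Fintype (Omega (a (Fin.last (n + 1))))] in
/-- `(1, …, 1, v)` is `mulSingle` at the last coordinate. [folklore] -/
theorem torusOfLast_eq_mulSingle [DecidableEq (Fin (n + 2))] (v : Omega (a (Fin.last (n + 1)))) :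
    torusOfLast ha v = Pi.mulSingle (Fin.last (n + 1)) (toRoot ha v) := by
  funext i
  refine Fin.lastCases ?_ (fun i' ↦ ?_) i
  · rw [Pi.mulSingle_eq_same]
    simp [torusOfLast]
  · rw [Pi.mulSingle_eq_of_ne (Fin.castSucc_lt_last i').ne]
    simp [torusOfLast]

omit [Fintype (Omega (a (Fin.last (n + 1))))] in
/-- `(u', 1)` with `u' = mulSingle i ζ` is `mulSingle i.castSucc ζ`. [folklore] -/
theorem torusOfInit_mulSingle [DecidableEq (Fin (n + 2))] [DecidableEq (Fin (n + 1))] (i : Fin (n + 1))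
    (ζ : rootsOfUnity (Fin.init a i) ℂ) :
    torusOfInit (a := a) (Pi.mulSingle i ζ) = Pi.mulSingle i.castSucc ζ := by
  funext k
  refine Fin.lastCases ?_ (fun i' ↦ ?_) k
  · rw [torusOfInit_last, Pi.mulSingle_eq_of_ne (Fin.castSucc_lt_last i).ne']
  · rw [torusOfInit_castSucc]
    by_cases h : i' = i
    · subst h
      rw [Pi.mulSingle_eq_same, Pi.mulSingle_eq_same]
    · rw [Pi.mulSingle_eq_of_ne h, Pi.mulSingle_eq_of_ne (fun h' ↦ h (Fin.castSucc_injective _ h'))]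
      rfl

omit [Fintype (Omega (a (Fin.last (n + 1))))] in
/-- A torus element is `(u', 1) · (1, …, 1, uₙ₊₁)`. [folklore] -/
theorem torusOfInit_mul_torusOfLast (u : Torus a) :
    torusOfInit (initT u) * torusOfLast ha (lastOmega u) = u := by
  funext k
  refine Fin.lastCases ?_ (fun i' ↦ ?_) k
  · rw [Pi.mul_apply, torusOfInit_last, one_mul]
    refine Subtype.ext (Units.ext ?_)
    simp [torusOfLast, toRoot, lastOmega]
  · rw [Pi.mul_apply, torusOfInit_castSucc]
    have h : torusOfLast ha (lastOmega u) i'.castSucc = 1 := by simp [torusOfLast]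
    rw [h, mul_one]
    rfl

omit [Fintype (Omega (a (Fin.last (n + 1))))] in
/-- `toRoot : Ω_{aₙ₊₁} → rootsOfUnity aₙ₊₁ ℂ` is a bijection. [folklore] -/
theorem toRoot_bijective : Function.Bijective (toRoot (a := a) ha) := by
  refine ⟨fun v w h ↦ Subtype.ext ?_, fun ζ ↦ ⟨⟨((ζ : ℂˣ) : ℂ), ?_⟩, Subtype.ext (Units.ext rfl)⟩⟩
  · have h1 := congrArg (fun t : rootsOfUnity (a (Fin.last (n + 1))) ℂ ↦ ((t : ℂˣ) : ℂ)) h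
    exact h1
  · rw [mem_Omega]
    have h := ζ.2
    rw [_root_.mem_rootsOfUnity] at h
    have h' := congrArg (fun x : ℂˣ ↦ (x : ℂ)) h
    simpa using h'

omit [Fintype (Omega (a (Fin.last (n + 1))))] in
/-- `toRoot` is multiplicative. [folklore] -/
theorem toRoot_omegaMul (v k : Omega (a (Fin.last (n + 1)))) :
    toRoot ha (omegaMul v k) = toRoot ha v * toRoot ha k :=
  Subtype.ext (Units.ext rfl)

/-- **`Σ_ω θ(1, …, 1, ω)⁻¹ = 0` for `θ` non-trivial on the last factor** (a non-trivial character
sums to zero over a finite group). [folklore] -/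
theorem sum_inv_torusOfLast_eq_zero (θ : Torus a →* ℂˣ)
    (hlast : ∃ ζ : rootsOfUnity (a (Fin.last (n + 1))) ℂ,
      θ (Pi.mulSingle (Fin.last (n + 1)) ζ) ≠ 1) :
    ∑ k : Omega (a (Fin.last (n + 1))), (((θ (torusOfLast ha k))⁻¹ : ℂˣ) : ℂ) = 0 := by
  classical
  haveI : NeZero (a (Fin.last (n + 1))) := ⟨ha _⟩
  haveI : Fintype (rootsOfUnity (a (Fin.last (n + 1))) ℂ) := Fintype.ofFinite _
  -- the character of the last factor, into `ℂ`
  set χ : rootsOfUnity (a (Fin.last (n + 1))) ℂ →* ℂ :=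
    (Units.coeHom ℂ).comp (θ.comp (MonoidHom.mulSingle (fun j : Fin (n + 2) ↦ rootsOfUnity (a j) ℂ)
      (Fin.last (n + 1)))) with hχ
  have hχapply : ∀ ζ, χ ζ = ((θ (Pi.mulSingle (Fin.last (n + 1)) ζ) : ℂˣ) : ℂ) := fun ζ ↦ rfl
  have hχ1 : χ ≠ 1 := by
    obtain ⟨ζ, hζ⟩ := hlast
    intro h
    apply hζ
    have h2 := DFunLike.congr_fun h ζ
    rw [hχapply, MonoidHom.one_apply] at h2
    exact Units.val_eq_one.mp h2
  have hsum := sum_hom_units_eq_zero χ hχ1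
  let φ : Omega (a (Fin.last (n + 1))) ≃ rootsOfUnity (a (Fin.last (n + 1))) ℂ :=
    Equiv.ofBijective (toRoot ha) (toRoot_bijective ha)
  calc ∑ k : Omega (a (Fin.last (n + 1))), (((θ (torusOfLast ha k))⁻¹ : ℂˣ) : ℂ)
      = ∑ k : Omega (a (Fin.last (n + 1))), χ ((φ k)⁻¹) := by
        refine Finset.sum_congr rfl fun k _ ↦ ?_
        rw [hχapply, ← map_inv, torusOfLast_eq_mulSingle ha, Pi.mulSingle_inv]
        rfl
    _ = ∑ ζ : rootsOfUnity (a (Fin.last (n + 1))) ℂ, χ ζ⁻¹ :=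
        Equiv.sum_comp φ (fun ζ ↦ χ ζ⁻¹)
    _ = ∑ ζ : rootsOfUnity (a (Fin.last (n + 1))) ℂ, χ ζ := by
        rw [← Equiv.sum_comp (Equiv.inv (rootsOfUnity (a (Fin.last (n + 1))) ℂ)) (fun ζ ↦ χ ζ)]
        rfl
    _ = 0 := hsum

/-- The `V`-component of the first Mayer–Vietoris map kills a class of the middle region all of
whose colour components have augmentation zero (`n = 0`: the upper colour pieces are
contractible, so a class of `H₀` of one of them with `ε = 0` vanishes).
[cite: HatcherAT2002, Prop. 2.6 and Prop. 2.7] -/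
theorem map_inclusion_right_eq_zero_of_ε
    (wk : ∀ k : Omega (a (Fin.last (n + 1))), singularHomology ℂ ℂ (middleColourPiece a ha k) 0)
    (hε : ∀ k, singularHomology.ε ℂ ℂ (middleColourPiece a ha k) (wk k) = 0) :
    singularHomology.map ℂ ℂ (subsetInclusion (Set.inter_subset_right : lowerPiece a ∩ upperPiece a ⊆ upperPiece a)) 0
      (∑ k, singularHomology.map ℂ ℂ (subsetIncl (middleColourPiece a ha k)) 0 (wk k)) = 0 := by
  rw [map_sum]
  refine Finset.sum_eq_zero fun k _ ↦ ?_
  rw [← ModuleCat.comp_apply, ← singularHomology.map_comp, incl_comp_subsetIncl_middle ha k,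
    singularHomology.map_comp, ModuleCat.comp_apply]
  have hz : singularHomology.map ℂ ℂ (middleToUpper ha k) 0 (wk k) = 0 := by
    haveI := contractibleSpace_upperColourPiece ha k
    haveI := singularHomology.isIso_ε_of_contractibleSpace ℂ ℂ (X := upperColourPiece a ha k)
    apply (ConcreteCategory.bijective_of_isIso (singularHomology.ε ℂ ℂ (upperColourPiece a ha k))).1
    rw [map_zero, ← ModuleCat.comp_apply, singularHomology.map_ε, hε k]
  rw [hz, map_zero]

/-- The augmentation of an eigenvector of `H₀(J'; ℂ)` for a non-trivial character vanishes.
[cite: HatcherAT2002, Prop. 2.7] -/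
theorem ε_eq_zero_of_eigenvector {b : ℕ} {a' : Fin (b + 1) → ℕ} {θ' : Torus a' → ℂ}
    (y : singularHomology ℂ ℂ (join a') 0) (hy : ∀ u', actRep a' 0 u' y = θ' u' • y)
    (hne : ∃ u', θ' u' ≠ 1) : singularHomology.ε ℂ ℂ (join a') y = 0 := by
  obtain ⟨u', hu'⟩ := hne
  have h : singularHomology.ε ℂ ℂ (join a') (actRep a' 0 u' y) = singularHomology.ε ℂ ℂ (join a') y := by
    rw [actRep]
    change (singularHomology.map ℂ ℂ (act a' u' : C(join a', join a')) 0 ≫ singularHomology.ε ℂ ℂ (join a')) y = _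
    rw [singularHomology.map_ε]
  rw [hy u', map_smul] at h
  have h2 : (θ' u' - 1) • singularHomology.ε ℂ ℂ (join a') y = 0 := by
    rw [sub_smul, one_smul, h, sub_self]
  exact (smul_eq_zero.mp h2).resolve_left (sub_ne_zero.mpr hu')

include ha in
/-- **The inductive step**: from a non-zero `θ'`-eigenvector `y` of `Hₙ(J'; ℂ)`
(`θ'(u') = θ(u', 1)`), for `θ` non-trivial on the last factor (and, when `n = 0`, `θ'`
non-trivial), a non-zero `θ`-eigenvector of `Hₙ₊₁(J; ℂ)`: the family
`Y = (θ(1, …, 1, ω)⁻¹ y)_ω ∈ ⊕_ω Hₙ(J')` is `ρ`-covariant, and it is the image `Ψ x` of a class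
`x ∈ Hₙ₊₁(J)` because the corresponding class of the middle region dies in `Hₙ(U)`
(`Σ_ω θ(1,…,1,ω)⁻¹ = 0`) and in `Hₙ(V)` (zero for `n ≠ 0`, augmentations for `n = 0`), by the
exactness of Mayer–Vietoris at `Hₙ(U ∩ V)`; `x` is the eigenvector (`Ψ` injective and
equivariant). [cite: Milnor1968, §9 Thm. 9.1 and p. 77] [cite: HatcherAT2002, §2.2 pp. 149–150] -/
theorem exists_eigenvector_step (θ : Torus a →* ℂˣ)
    (hlast : ∃ ζ : rootsOfUnity (a (Fin.last (n + 1))) ℂ, θ (Pi.mulSingle (Fin.last (n + 1)) ζ) ≠ 1)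
    (y : singularHomology ℂ ℂ (join (Fin.init a)) n) (hy0 : y ≠ 0)
    (hy : ∀ u', actRep (Fin.init a) n u' y = ((θ (torusOfInit u') : ℂˣ) : ℂ) • y)
    (hinit : ∃ u', θ (torusOfInit u') ≠ 1) :
    ∃ x : singularHomology ℂ ℂ (join a) (n + 1), x ≠ 0 ∧
      ∀ u, actRep a (n + 1) u x = ((θ u : ℂˣ) : ℂ) • x := by
  classical
  have hexc := relativeSingularHomology.isIso_map_of_interior_union_interior_holds ℂ ℂ (join a)
  -- the target family and the corresponding class of the middle region
  set c : Omega (a (Fin.last (n + 1))) → ℂ := fun k ↦ (((θ (torusOfLast ha k))⁻¹ : ℂˣ) : ℂ) with hc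
  set Y : Omega (a (Fin.last (n + 1))) → singularHomology ℂ ℂ (join (Fin.init a)) n :=
    fun k ↦ c k • y with hY
  have hwk : ∀ k, ∃ wk : singularHomology ℂ ℂ (middleColourPiece a ha k) n,
      singularHomology.map ℂ ℂ (middleRetract a ha k) n wk = Y k :=
    fun k ↦ (map_middleRetract_bijective ℂ ha k n).2 (Y k)
  choose wk hwk using hwk
  set w : singularHomology ℂ ℂ ↥(lowerPiece a ∩ upperPiece a) n :=
    ∑ k, singularHomology.map ℂ ℂ (subsetIncl (middleColourPiece a ha k)) n (wk k) with hw
  -- `w` dies in `Hₙ(U)`: push to `J'` by the retraction, where it becomes `(Σ c k) • y = 0`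
  have hU : singularHomology.map ℂ ℂ
      (subsetInclusion (Set.inter_subset_left : lowerPiece a ∩ upperPiece a ⊆ lowerPiece a)) n w = 0 := by
    apply (map_lowerRetract_bijective ℂ ha n).1
    rw [map_zero, hw, map_sum, map_sum]
    have h : ∀ k, singularHomology.map ℂ ℂ (lowerRetract a ha) n
        (singularHomology.map ℂ ℂ (subsetInclusion
          (Set.inter_subset_left : lowerPiece a ∩ upperPiece a ⊆ lowerPiece a)) n
          (singularHomology.map ℂ ℂ (subsetIncl (middleColourPiece a ha k)) n (wk k))) = Y k := by
      intro k
      rw [← hwk k, middleRetract_eq_comp ha k, singularHomology.map_comp, singularHomology.map_comp,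
        ModuleCat.comp_apply, ModuleCat.comp_apply]
    simp only [h, hY, ← Finset.sum_smul]
    rw [sum_inv_torusOfLast_eq_zero ha θ hlast, zero_smul]
  -- `w` dies in `Hₙ(V)`
  have hV : singularHomology.map ℂ ℂ
      (subsetInclusion (Set.inter_subset_right : lowerPiece a ∩ upperPiece a ⊆ upperPiece a)) n w = 0 := by
    by_cases hn : n = 0
    · subst hn
      refine map_inclusion_right_eq_zero_of_ε ha wk fun k ↦ ?_
      have h1 : singularHomology.ε ℂ ℂ (middleColourPiece a ha k) (wk k) =
          singularHomology.ε ℂ ℂ (join (Fin.init a)) (Y k) := by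
        rw [← hwk k, ← ModuleCat.comp_apply, singularHomology.map_ε]
      rw [h1, hY]
      change singularHomology.ε ℂ ℂ (join (Fin.init a)) (c k • y) = 0
      rw [map_smul, ε_eq_zero_of_eigenvector y hy ?_, smul_zero]
      obtain ⟨u', hu'⟩ := hinit
      exact ⟨u', fun h ↦ hu' (Units.val_eq_one.mp h)⟩
    · exact eq_zero_of_isZero ℂ (isZero_singularHomology_upperPiece ℂ ha hn) _
  -- hence `w = δ x`
  have hφ : mayerVietoris.φ ℂ ℂ (lowerPiece a) (upperPiece a) n w = 0 := by
    refine biprod_apply_ext ?_ ?_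
    · rw [mayerVietoris.φ, biprod_fst_lift_apply, hU, map_zero]
    · rw [mayerVietoris.φ, biprod_snd_lift_apply, map_zero]
      simp only [ModuleCat.hom_neg, LinearMap.neg_apply, neg_eq_zero]
      exact hV
  obtain ⟨x, hx⟩ := (ShortComplex.moduleCat_exact_iff _).1
    (mayerVietoris.exact₃_holds (R := ℂ) (M := ℂ) (lowerPiece a) (upperPiece a) hexc
      interior_lowerPiece_union_interior_upperPiece n) w hφ
  change mvδ x = w at hx
  -- `Ψ x = Y`
  have hPsi : Psi ha x = Y := by
    funext k
    rw [Psi_apply, hx, hw, comps_eq_of_sum_eq ha rfl, hwk k]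
  refine ⟨x, ?_, fun u ↦ ?_⟩
  · intro h0
    apply hy0
    have h1 : Y ⟨1, one_mem_Omega _⟩ = 0 := by rw [← hPsi, h0, map_zero]; rfl
    have hc1 : c ⟨1, one_mem_Omega _⟩ = 1 := by
      have : torusOfLast ha (⟨1, one_mem_Omega _⟩ : Omega (a (Fin.last (n + 1)))) = 1 := by
        rw [torusOfLast_eq_mulSingle ha]
        have ht : toRoot ha (⟨1, one_mem_Omega _⟩ : Omega (a (Fin.last (n + 1)))) = 1 :=
          Subtype.ext (Units.ext rfl)
        rw [ht, Pi.mulSingle_one]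
      simp [hc, this]
    simpa [hY, hc1] using h1
  · apply Psi_injective ha
    rw [Psi_actRep, map_smul, hPsi]
    funext k
    rw [rho_apply, Pi.smul_apply, hY]
    change actRep (Fin.init a) n (initT u) (c _ • y) = ((θ u : ℂˣ) : ℂ) • (c k • y)
    rw [map_smul, hy, smul_smul, smul_smul]
    congr 1
    -- `c (uₙ₊₁⁻¹ k) θ(u', 1) = θ(u) c k`
    simp only [hc]
    have hk : torusOfLast ha (omegaMul (omegaInv (lastOmega u)) k) =
        (torusOfLast ha (lastOmega u))⁻¹ * torusOfLast ha k := by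
      rw [torusOfLast_eq_mulSingle ha, torusOfLast_eq_mulSingle ha, torusOfLast_eq_mulSingle ha,
        ← Pi.mulSingle_inv, ← Pi.mulSingle_mul]
      congr 1
      refine Subtype.ext (Units.ext ?_)
      simp [toRoot, omegaMul, omegaInv]
    rw [hk, map_mul, map_inv, mul_inv, inv_inv]
    have hu : ((θ u : ℂˣ) : ℂ) = ((θ (torusOfInit (initT u)) : ℂˣ) : ℂ) * ((θ (torusOfLast ha (lastOmega u)) : ℂˣ) : ℂ) := by
      rw [← Units.val_mul, ← map_mul, torusOfInit_mul_torusOfLast ha u]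
    rw [hu]
    simp only [Units.val_mul, Units.val_inv_eq_inv_val]
    ring

end Step

/-! ### Existence of eigenvectors: the theorem -/

/-- **Every character of the torus `Ω_{a₀} × ⋯ × Ω_{aₙ}` which is non-trivial on every factor
occurs in `Hₙ(Ω_{a₀} * ⋯ * Ω_{aₙ}; ℂ)`**: there is a non-zero class `x` with `(act u)_* x = θ(u) x`
for all `u` (Pham; Milnor Thm. 9.1: `H̃ₙ(J) = ⊗ⱼ H̃₀(Ω_{aⱼ})`, the factors acting through their
regular representations minus the trivial one; all exponents `aⱼ ≠ 0`).
[cite: Milnor1968, §9 Thm. 9.1 and p. 77] [cite: Pham1965, §1] [cite: Dimca1992, Ch. 3 (1.16)] -/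
theorem exists_eigenvector :
    ∀ {n : ℕ} {a : Fin (n + 1) → ℕ} (_ : ∀ i, a i ≠ 0) (θ : Torus a →* ℂˣ)
      (_ : ∀ j : Fin (n + 1), ∃ ζ : rootsOfUnity (a j) ℂ, θ (Pi.mulSingle j ζ) ≠ 1),
      ∃ x : singularHomology ℂ ℂ (join a) n, x ≠ 0 ∧ ∀ u, actRep a n u x = ((θ u : ℂˣ) : ℂ) • x
  | 0, _, ha, θ, _ => exists_eigenvector_base ha θ
  | n + 1, a, ha, θ, hθ => by
    classical
    haveI : Fintype (Omega (a (Fin.last (n + 1)))) := (finite_Omega (ha _)).fintype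
    -- the character `θ' = θ(·, 1)` of the torus of `J'` is non-trivial on every factor
    set θ' : Torus (Fin.init a) →* ℂˣ := θ.comp torusOfInitHom with hθ'
    have hθ' : ∀ i : Fin (n + 1), ∃ ζ : rootsOfUnity (Fin.init a i) ℂ, θ' (Pi.mulSingle i ζ) ≠ 1 := by
      intro i
      obtain ⟨ζ, hζ⟩ := hθ i.castSucc
      refine ⟨ζ, ?_⟩
      rw [hθ', MonoidHom.comp_apply, torusOfInitHom_apply, torusOfInit_mulSingle]
      exact hζ
    obtain ⟨y, hy0, hy⟩ := exists_eigenvector (init_ne_zero ha) θ' hθ'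
    refine exists_eigenvector_step ha θ (hθ (Fin.last (n + 1))) y hy0 (fun u' ↦ hy u') ?_
    obtain ⟨ζ, hζ⟩ := hθ' 0
    exact ⟨Pi.mulSingle 0 ζ, hζ⟩

end PhamBrieskorn

end Literature.Geometry.ComplexAnalytic

end
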